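import Summits.HodgeConjecture.HodgeConjecture.Theorems.Ring2WeilCoverageCMFieldRationalPrimeRule
import Summits.HodgeConjecture.HodgeConjecture.Theorems.Ring2WeilCoverageCMFieldNormResidueSymbolsDyadicCarriers
import HarnessLib

/-!
# Ring 2 — Weil-family coverage, CM-field rows: THE RATIONAL PRIME RULE, instances V: the census fields `ℚ(ζ₁₂) = ℚ(i,√3)`, `ℚ(√-3,√5)`, `ℚ(i,√5)` (§b03.5; the classifications of b03.16 re-derived uniformly)
  (WEIL-FAMILY-COVERAGE «## b03», cell (xxi′), part 20)

research route conditional on HC_CM; not a corollary; Q11.4-sentence-2 already refuted in dim ≥ 3.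

For each biquadratic census carrier `R = S² + pS + q` below (`E = ℚ[T]/(R(T²)) = F(√b₀)`, `F = ℚ[S]/(R) = ℚ(√d)`,
`b₀ ∈ {-1, -2, -3, -5}`) [cite: Deligne1982HodgeCycles, §4 p. 30, (1), Cor. 4.2] the column «primes: `[ℓ] ≠ [1] ⟺ …`» of
the census tables (§b03.5 / §b03.29 (3), tier S: projection formula) becomes a KERNEL THEOREM for EVERY rational prime `ℓ`:
**`[ℓ] ≠ [(-1)^k]` (`k` even) `⟺ ℓ mod N ∈ {…}`** — by part 14's rule (`ℓ` odd, `ℓ ∤ disc·b₀`: `(disc|ℓ) = 1 ∧ (b₀|ℓ) = -1`),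
part 15's Legendre-symbol congruences, and explicit norms `ℓ = x² - b₀y²` at the finitely many primes `ℓ ∣ 2·disc·b₀`.
Per carrier: `√d ∈ 𝓞_F` (resp. the golden integer for `d = 5`), the uniqueness of the dyadic place of `F` (part 13:
`(2, π)² = (2)` resp. `N v₂ = 4`), the split classes of the special primes, and the rule.
* `ℚ(ζ₁₂) = ℚ(i,√3)` (`R = S² + 8S + 4`): `[ℓ] ≠ [1] ⟺ ℓ ≡ 11 (mod 12)`.
* `ℚ(√-3,√5)` (`R = S² + 9S + 9`): `[ℓ] ≠ [1] ⟺ ℓ ≡ 11, 14 (mod 15)`.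
* `ℚ(i,√5)` (`R = S² + 3S + 1`): `[ℓ] ≠ [1] ⟺ ℓ ≡ 11, 19 (mod 20)`.
No new definition, no named fact, no sorry; nothing about the Hodge conjecture is asserted.
-/

noncomputable section

set_option linter.dupNamespace false

open Polynomial NumberField IsDedekindDomain

namespace Summit.HodgeConjecture.HodgeConjecture.Ring2.WeilCoverageCM

open Literature.AlgebraicGeometry.Deligne1982
open Literature.AlgebraicGeometry.HodgeTheory (splitDiscriminantClassCM)
open Literature.NumberTheory.QuadraticForms

variable {R : Polynomial ℤ} [Fact (Irreducible (cmPolyQ R))] [Fact (Irreducible (realPolyQ R))]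

/-! ### §49 `E = ℚ(ζ₁₂) = ℚ(i,√3)` (`R = S² + 8S + 4`, `F = ℚ(√3)`, `E = F(√-1)`, `p² - 4q = 48 = 3·4²`):
  `[ℓ] ≠ [1] ⟺ ℓ ≡ 11 (mod 12)` -/
section Izeta12
/-- **`[2] = [1]`** for `ℚ(ζ₁₂) = ℚ(i,√3)`: `2 = x² - (-1)·y²` with `x = 1`, `y = 1` in `F` (a norm from `E`).
[cite: Deligne1982HodgeCycles, §4 Cor. 4.2] -/
theorem zeta12_ratPrimeRule_mk_two_eq_splitDiscriminantClassCM (hR : R = X ^ 2 + C 8 * X + C 4) (qℓ : (realField R)ˣ) (hq : (qℓ : realField R) = 2)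
    {k : ℕ} (hk : Even k) : (QuotientGroup.mk qℓ : cmNormResidueGroup R) = splitDiscriminantClassCM R k := by
  have hrel := root_rel_quadratic hR
  push_cast at hrel
  have hfac : AdjoinRoot.root (realPolyQ R) = ((-1 : realField R) + (-1/2 : realField R) * AdjoinRoot.root (realPolyQ R)) ^ 2 * (-1 : realField R) := by
    linear_combination (1/4 : realField R) * hrel
  exact mk_eq_splitDiscriminantClassCM_of_eq_sq_sub_mul_sq hfac qℓ (x := (1 : realField R)) (y := (1 : realField R))
    (by rw [hq]; linear_combination (0 : realField R) * hrel) hk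

/-- **`[3] = [1]`** for `ℚ(ζ₁₂) = ℚ(i,√3)`: `3 = x² - (-1)·y²` with `x = (θ + 4)/2`, `y = 0` in `F` (a norm from `E`).
[cite: Deligne1982HodgeCycles, §4 Cor. 4.2] -/
theorem zeta12_ratPrimeRule_mk_three_eq_splitDiscriminantClassCM (hR : R = X ^ 2 + C 8 * X + C 4) (qℓ : (realField R)ˣ) (hq : (qℓ : realField R) = 3)
    {k : ℕ} (hk : Even k) : (QuotientGroup.mk qℓ : cmNormResidueGroup R) = splitDiscriminantClassCM R k := by
  have hrel := root_rel_quadratic hR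
  push_cast at hrel
  have hfac : AdjoinRoot.root (realPolyQ R) = ((-1 : realField R) + (-1/2 : realField R) * AdjoinRoot.root (realPolyQ R)) ^ 2 * (-1 : realField R) := by
    linear_combination (1/4 : realField R) * hrel
  exact mk_eq_splitDiscriminantClassCM_of_eq_sq_sub_mul_sq hfac qℓ (x := ((2 : realField R) + (1/2 : realField R) * AdjoinRoot.root (realPolyQ R))) (y := (0 : realField R))
    (by rw [hq]; linear_combination (-1/4 : realField R) * hrel) hk

/-- **THE RATIONAL PRIME RULE for `ℚ(ζ₁₂) = ℚ(i,√3)`**: for EVERY rational prime `ℓ`, the class `[ℓ]` of the census table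
`W_{2k}.E.δ` (`k` even) is non-split iff **`ℓ ≡ 11 (mod 12)`** — i.e. iff `ℓ` splits in `F = ℚ(√3)` into two places
inert in `E = F(√-1)` (`(48|ℓ) = 1`, `(-1|ℓ) = -1`); the primes `ℓ ∣ 2·48·1` are norms.
[cite: Deligne1982HodgeCycles, §4 (1) and Cor. 4.2] [cite: Omeara1963, §63B Example 63:12 and §71D Thm. 71:18] -/
theorem zeta12_mk_prime_ne_splitDiscriminantClassCM_iff_mod (hR : R = X ^ 2 + C 8 * X + C 4) {ℓ : ℕ} (hℓ : ℓ.Prime)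
    (qℓ : (realField R)ˣ) (hq : (qℓ : realField R) = ℓ) {k : ℕ} (hk : Even k) :
    (QuotientGroup.mk qℓ : cmNormResidueGroup R) ≠ splitDiscriminantClassCM R k ↔
      ℓ % 12 = 11 := by
  by_cases h2 : ℓ = 2
  · subst h2
    exact iff_of_false (not_not.2 (zeta12_ratPrimeRule_mk_two_eq_splitDiscriminantClassCM hR qℓ (by rw [hq]; norm_num) hk))
      (by omega)
  by_cases h3 : ℓ = 3
  · subst h3
    exact iff_of_false (not_not.2 (zeta12_ratPrimeRule_mk_three_eq_splitDiscriminantClassCM hR qℓ (by rw [hq]; norm_num) hk))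
      (by omega)
  haveI := Fact.mk hℓ
  obtain ⟨hRm, -⟩ := monic_and_natDegree_of_quadratic R hR
  obtain ⟨θₒ, hθ⟩ := exists_ringOfIntegers_coe_eq_root hRm
  have hroots := roots_real_neg_of_quadratic hR (by norm_num) (by norm_num) (by norm_num)
  have hrel := root_rel_quadratic hR
  push_cast at hrel
  have hdisc : ¬ (ℓ : ℤ) ∣ (8 : ℤ) ^ 2 - 4 * 4 := fun h ↦ by
    have h' : ℓ ∣ 2 ^ 4 * 3 ^ 1 * 5 ^ 0 := by norm_num at h ⊢; exact_mod_cast h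
    rcases eq_of_prime_dvd_two_pow_mul hℓ h' with rfl | rfl | rfl <;> omega
  have hm0 : (4 : ZMod ℓ) ≠ 0 := by
    have h : ¬ ℓ ∣ 4 := fun h ↦ by
      rcases eq_of_prime_dvd_two_pow_mul hℓ (a := 2) (b := 0) (c := 0) (by norm_num; exact h) with rfl | rfl | rfl <;> omega
    have := (not_congr (ZMod.natCast_eq_zero_iff 4 ℓ)).2 h
    exact_mod_cast this
  have hfac : AdjoinRoot.root (realPolyQ R) = -((-1 : realField R) + (-1/2 : realField R) * AdjoinRoot.root (realPolyQ R)) ^ 2 := by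
    linear_combination (1/4 : realField R) * hrel
  rw [mk_natCast_ne_splitDiscriminantClassCM_iff_of_root_eq_neg_sq hR hroots hθ hfac (zeta12_dyadic_unique hR) hℓ h2 hdisc
    qℓ hq hk]
  push_cast
  rw [show (48 : ZMod ℓ) = 3 * 4 ^ 2 by norm_num, isSquare_mul_sq_iff_of_ne_zero hm0, isSquare_three_iff h2 h3, ZMod.exists_sq_eq_neg_one_iff]
  have hodd : ℓ % 2 = 1 := (Nat.Prime.mod_two_eq_one_iff_ne_two hℓ).2 h2
  have h3' : ℓ % 3 ≠ 0 := fun h ↦ h3 ((Nat.prime_dvd_prime_iff_eq Nat.prime_three hℓ).1 (Nat.dvd_of_mod_eq_zero h)).symm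
  have key : ∀ n : ℕ, n % 2 = 1 → n % 3 ≠ 0 →
      (((n % 12 = 1 ∨ n % 12 = 11) ∧ ¬ (n % 4 ≠ 3)) ↔ (n % 12 = 11)) := by
    intro n hn0 hn1
    obtain ⟨k', r, hr, rfl⟩ : ∃ k' r, r < 12 ∧ n = 12 * k' + r :=
      ⟨n / 12, n % 12, Nat.mod_lt _ (by norm_num), (Nat.div_add_mod n 12).symm⟩
    interval_cases r <;> omega
  exact key ℓ hodd h3'

end Izeta12


/-! ### §50 `E = ℚ(√-3,√5)` (`R = S² + 9S + 9`, `F = ℚ(√5)`, `E = F(√-3)`, `p² - 4q = 45 = 5·3²`):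
  `[ℓ] ≠ [1] ⟺ ℓ ≡ 11, 14 (mod 15)` -/
section IsqrtNeg3Sqrt5
omit [Fact (Irreducible (cmPolyQ R))] in
/-- `√5 = (2θ + 9)/3` is an algebraic integer of `F` with square `5`. [folklore] -/
theorem sqrtNeg3Sqrt5_ratPrimeRule_exists_sq_eq_5 (hR : R = X ^ 2 + C 9 * X + C 9) :
    ∃ s : 𝓞 (realField R), (s : realField R) = (2 * AdjoinRoot.root (realPolyQ R) + 9) / 3 ∧ s ^ 2 = 5 := by
  have hrel := root_rel_quadratic hR
  push_cast at hrel
  have hsq : ((2 * AdjoinRoot.root (realPolyQ R) + 9) / 3) ^ 2 = (5 : realField R) := by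
    field_simp
    linear_combination (4 : realField R) * hrel
  have hint : IsIntegral ℤ ((2 * AdjoinRoot.root (realPolyQ R) + 9) / 3 : realField R) := by
    refine ⟨X ^ 2 - C 5, by monicity!, ?_⟩
    simp [hsq]
  refine ⟨⟨_, hint⟩, rfl, ?_⟩
  refine RingOfIntegers.ext ?_
  simp only [map_pow, map_ofNat]
  exact hsq

omit [Fact (Irreducible (cmPolyQ R))] in
/-- The golden integer `ω = (1 + √5)/2 = (2θ + 9 + 3)/6 ∈ 𝓞_F`: `ω² = ω + 1`. [folklore] -/
theorem sqrtNeg3Sqrt5_ratPrimeRule_exists_golden (hR : R = X ^ 2 + C 9 * X + C 9) :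
    ∃ s : 𝓞 (realField R), (s : realField R) = (2 * AdjoinRoot.root (realPolyQ R) + 9 + 3) / 6 ∧ s ^ 2 = s + 1 := by
  have hrel := root_rel_quadratic hR
  push_cast at hrel
  have hsq : ((2 * AdjoinRoot.root (realPolyQ R) + 9 + 3) / 6) ^ 2 = (2 * AdjoinRoot.root (realPolyQ R) + 9 + 3) / 6 + (1 : realField R) := by
    field_simp
    linear_combination (4 : realField R) * hrel
  have hint : IsIntegral ℤ ((2 * AdjoinRoot.root (realPolyQ R) + 9 + 3) / 6 : realField R) := by
    refine ⟨X ^ 2 - X - C 1, by monicity!, ?_⟩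
    simp [hsq]
  refine ⟨⟨_, hint⟩, rfl, ?_⟩
  refine RingOfIntegers.ext ?_
  simp only [map_pow, map_add, map_one]
  exact hsq

omit [Fact (Irreducible (cmPolyQ R))] in
/-- **`F = ℚ(√5)` has exactly one dyadic place** (in this carrier's terms). [folklore] -/
theorem sqrtNeg3Sqrt5_ratPrimeRule_dyadic_unique (hR : R = X ^ 2 + C 9 * X + C 9) (v v' : HeightOneSpectrum (𝓞 (realField R)))
    (h2 : (2 : 𝓞 (realField R)) ∈ v.asIdeal) (h2' : (2 : 𝓞 (realField R)) ∈ v'.asIdeal) : v = v' := by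
  obtain ⟨s, -, hs⟩ := sqrtNeg3Sqrt5_ratPrimeRule_exists_golden hR
  have hx : ∀ w : HeightOneSpectrum (𝓞 (realField R)), s ^ 2 - s ∉ w.asIdeal := fun w h ↦
    w.isPrime.ne_top ((Ideal.eq_top_iff_one _).2 (by rwa [show s ^ 2 - s = 1 by rw [hs]; ring] at h))
  exact dyadic_unique_of_sq_sub_self_notMem (finrank_realField_quadratic hR) v v' h2 h2' (hx v) (hx v')

/-- **`[2] = [1]`** for `ℚ(√-3,√5)`: `2 = x² - (-3)·y²` with `x = (2*θ + 9)/6`, `y = 1/2` in `F` (a norm from `E`).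
[cite: Deligne1982HodgeCycles, §4 Cor. 4.2] -/
theorem sqrtNeg3Sqrt5_ratPrimeRule_mk_two_eq_splitDiscriminantClassCM (hR : R = X ^ 2 + C 9 * X + C 9) (qℓ : (realField R)ˣ) (hq : (qℓ : realField R) = 2)
    {k : ℕ} (hk : Even k) : (QuotientGroup.mk qℓ : cmNormResidueGroup R) = splitDiscriminantClassCM R k := by
  have hrel := root_rel_quadratic hR
  push_cast at hrel
  have hfac : AdjoinRoot.root (realPolyQ R) = ((1 : realField R) + (1/3 : realField R) * AdjoinRoot.root (realPolyQ R)) ^ 2 * (-3 : realField R) := by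
    linear_combination (1/3 : realField R) * hrel
  exact mk_eq_splitDiscriminantClassCM_of_eq_sq_sub_mul_sq hfac qℓ (x := ((3/2 : realField R) + (1/3 : realField R) * AdjoinRoot.root (realPolyQ R))) (y := (1/2 : realField R))
    (by rw [hq]; linear_combination (-1/9 : realField R) * hrel) hk

/-- **`[3] = [1]`** for `ℚ(√-3,√5)`: `3 = x² - (-3)·y²` with `x = 0`, `y = 1` in `F` (a norm from `E`).
[cite: Deligne1982HodgeCycles, §4 Cor. 4.2] -/
theorem sqrtNeg3Sqrt5_ratPrimeRule_mk_three_eq_splitDiscriminantClassCM (hR : R = X ^ 2 + C 9 * X + C 9) (qℓ : (realField R)ˣ) (hq : (qℓ : realField R) = 3)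
    {k : ℕ} (hk : Even k) : (QuotientGroup.mk qℓ : cmNormResidueGroup R) = splitDiscriminantClassCM R k := by
  have hrel := root_rel_quadratic hR
  push_cast at hrel
  have hfac : AdjoinRoot.root (realPolyQ R) = ((1 : realField R) + (1/3 : realField R) * AdjoinRoot.root (realPolyQ R)) ^ 2 * (-3 : realField R) := by
    linear_combination (1/3 : realField R) * hrel
  exact mk_eq_splitDiscriminantClassCM_of_eq_sq_sub_mul_sq hfac qℓ (x := (0 : realField R)) (y := (1 : realField R))
    (by rw [hq]; linear_combination (0 : realField R) * hrel) hk

/-- **`[5] = [1]`** for `ℚ(√-3,√5)`: `5 = x² - (-3)·y²` with `x = (2*θ + 9)/3`, `y = 0` in `F` (a norm from `E`).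
[cite: Deligne1982HodgeCycles, §4 Cor. 4.2] -/
theorem sqrtNeg3Sqrt5_ratPrimeRule_mk_five_eq_splitDiscriminantClassCM (hR : R = X ^ 2 + C 9 * X + C 9) (qℓ : (realField R)ˣ) (hq : (qℓ : realField R) = 5)
    {k : ℕ} (hk : Even k) : (QuotientGroup.mk qℓ : cmNormResidueGroup R) = splitDiscriminantClassCM R k := by
  have hrel := root_rel_quadratic hR
  push_cast at hrel
  have hfac : AdjoinRoot.root (realPolyQ R) = ((1 : realField R) + (1/3 : realField R) * AdjoinRoot.root (realPolyQ R)) ^ 2 * (-3 : realField R) := by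
    linear_combination (1/3 : realField R) * hrel
  exact mk_eq_splitDiscriminantClassCM_of_eq_sq_sub_mul_sq hfac qℓ (x := ((3 : realField R) + (2/3 : realField R) * AdjoinRoot.root (realPolyQ R))) (y := (0 : realField R))
    (by rw [hq]; linear_combination (-4/9 : realField R) * hrel) hk

/-- **THE RATIONAL PRIME RULE for `ℚ(√-3,√5)`**: for EVERY rational prime `ℓ`, the class `[ℓ]` of the census table
`W_{2k}.E.δ` (`k` even) is non-split iff **`ℓ ≡ 11, 14 (mod 15)`** — i.e. iff `ℓ` splits in `F = ℚ(√5)` into two places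
inert in `E = F(√-3)` (`(45|ℓ) = 1`, `(-3|ℓ) = -1`); the primes `ℓ ∣ 2·45·3` are norms.
[cite: Deligne1982HodgeCycles, §4 (1) and Cor. 4.2] [cite: Omeara1963, §63B Example 63:12 and §71D Thm. 71:18] -/
theorem sqrtNeg3Sqrt5_mk_prime_ne_splitDiscriminantClassCM_iff_mod (hR : R = X ^ 2 + C 9 * X + C 9) {ℓ : ℕ} (hℓ : ℓ.Prime)
    (qℓ : (realField R)ˣ) (hq : (qℓ : realField R) = ℓ) {k : ℕ} (hk : Even k) :
    (QuotientGroup.mk qℓ : cmNormResidueGroup R) ≠ splitDiscriminantClassCM R k ↔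
      ℓ % 15 = 11 ∨ ℓ % 15 = 14 := by
  by_cases h2 : ℓ = 2
  · subst h2
    exact iff_of_false (not_not.2 (sqrtNeg3Sqrt5_ratPrimeRule_mk_two_eq_splitDiscriminantClassCM hR qℓ (by rw [hq]; norm_num) hk))
      (by omega)
  by_cases h3 : ℓ = 3
  · subst h3
    exact iff_of_false (not_not.2 (sqrtNeg3Sqrt5_ratPrimeRule_mk_three_eq_splitDiscriminantClassCM hR qℓ (by rw [hq]; norm_num) hk))
      (by omega)
  by_cases h5 : ℓ = 5
  · subst h5
    exact iff_of_false (not_not.2 (sqrtNeg3Sqrt5_ratPrimeRule_mk_five_eq_splitDiscriminantClassCM hR qℓ (by rw [hq]; norm_num) hk))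
      (by omega)
  haveI := Fact.mk hℓ
  obtain ⟨hRm, -⟩ := monic_and_natDegree_of_quadratic R hR
  obtain ⟨θₒ, hθ⟩ := exists_ringOfIntegers_coe_eq_root hRm
  have hroots := roots_real_neg_of_quadratic hR (by norm_num) (by norm_num) (by norm_num)
  have hrel := root_rel_quadratic hR
  push_cast at hrel
  have hdisc : ¬ (ℓ : ℤ) ∣ (9 : ℤ) ^ 2 - 4 * 9 := fun h ↦ by
    have h' : ℓ ∣ 2 ^ 0 * 3 ^ 2 * 5 ^ 1 := by norm_num at h ⊢; exact_mod_cast h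
    rcases eq_of_prime_dvd_two_pow_mul hℓ h' with rfl | rfl | rfl <;> omega
  have hm0 : (3 : ZMod ℓ) ≠ 0 := by
    have h : ¬ ℓ ∣ 3 := fun h ↦ by
      rcases eq_of_prime_dvd_two_pow_mul hℓ (a := 0) (b := 1) (c := 0) (by norm_num; exact h) with rfl | rfl | rfl <;> omega
    have := (not_congr (ZMod.natCast_eq_zero_iff 3 ℓ)).2 h
    exact_mod_cast this
  have hnsq : ¬ IsSquare (((5 : ℤ) : ℤ) : ZMod 3) := by decide
  obtain ⟨s, -, hs⟩ := sqrtNeg3Sqrt5_ratPrimeRule_exists_sq_eq_5 hR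
  have hs' : s ^ 2 = ((5 : ℤ) : 𝓞 (realField R)) := by rw [hs]; norm_num
  have hb := radicand_places_of_inert (finrank_realField_quadratic hR) hs' Nat.prime_three hnsq hℓ h3
  have hfac : AdjoinRoot.root (realPolyQ R) = ((1 : realField R) + (1/3 : realField R) * AdjoinRoot.root (realPolyQ R)) ^ 2 * (((-(3 : ℕ) : ℤ) : 𝓞 (realField R)) : realField R) := by
    rw [show (((-(3 : ℕ) : ℤ) : 𝓞 (realField R)) : realField R) = ((-(3 : ℕ) : ℤ) : realField R) from
      map_intCast (algebraMap (𝓞 (realField R)) (realField R)) _]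
    push_cast
    linear_combination (1/3 : realField R) * hrel
  have hℓb : ¬ (ℓ : ℤ) ∣ (-(3 : ℕ) : ℤ) := fun h ↦ h3 ((Nat.prime_dvd_prime_iff_eq hℓ Nat.prime_three).1 (by exact_mod_cast (dvd_neg.1 h)))
  rw [mk_natCast_ne_splitDiscriminantClassCM_iff_isSquare_disc hR hroots hθ hfac (sqrtNeg3Sqrt5_ratPrimeRule_dyadic_unique hR) hℓ h2 hdisc hℓb hb
    qℓ hq hk]
  push_cast
  rw [show (45 : ZMod ℓ) = 5 * 3 ^ 2 by norm_num, isSquare_mul_sq_iff_of_ne_zero hm0, isSquare_five_iff h2 h5, isSquare_neg_three_iff h2 h3]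
  have hodd : ℓ % 2 = 1 := (Nat.Prime.mod_two_eq_one_iff_ne_two hℓ).2 h2
  have h3' : ℓ % 3 ≠ 0 := fun h ↦ h3 ((Nat.prime_dvd_prime_iff_eq Nat.prime_three hℓ).1 (Nat.dvd_of_mod_eq_zero h)).symm
  have h5' : ℓ % 5 ≠ 0 := fun h ↦ h5 ((Nat.prime_dvd_prime_iff_eq Nat.prime_five hℓ).1 (Nat.dvd_of_mod_eq_zero h)).symm
  have key : ∀ n : ℕ, n % 2 = 1 → n % 3 ≠ 0 → n % 5 ≠ 0 →
      (((n % 5 = 1 ∨ n % 5 = 4) ∧ ¬ (n % 3 = 1)) ↔ (n % 15 = 11 ∨ n % 15 = 14)) := by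
    intro n hn0 hn1 hn2
    obtain ⟨k', r, hr, rfl⟩ : ∃ k' r, r < 15 ∧ n = 15 * k' + r :=
      ⟨n / 15, n % 15, Nat.mod_lt _ (by norm_num), (Nat.div_add_mod n 15).symm⟩
    interval_cases r <;> omega
  exact key ℓ hodd h3' h5'

end IsqrtNeg3Sqrt5


/-! ### §51 `E = ℚ(i,√5)` (`R = S² + 3S + 1`, `F = ℚ(√5)`, `E = F(√-1)`, `p² - 4q = 5 = 5·1²`):
  `[ℓ] ≠ [1] ⟺ ℓ ≡ 11, 19 (mod 20)` -/
section IsqrtNeg1Sqrt5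
omit [Fact (Irreducible (cmPolyQ R))] in
/-- The golden integer `ω = (1 + √5)/2 = (2θ + 3 + 1)/2 ∈ 𝓞_F`: `ω² = ω + 1`. [folklore] -/
theorem sqrtNeg1Sqrt5_ratPrimeRule_exists_golden (hR : R = X ^ 2 + C 3 * X + C 1) :
    ∃ s : 𝓞 (realField R), (s : realField R) = (2 * AdjoinRoot.root (realPolyQ R) + 3 + 1) / 2 ∧ s ^ 2 = s + 1 := by
  have hrel := root_rel_quadratic hR
  push_cast at hrel
  have hsq : ((2 * AdjoinRoot.root (realPolyQ R) + 3 + 1) / 2) ^ 2 = (2 * AdjoinRoot.root (realPolyQ R) + 3 + 1) / 2 + (1 : realField R) := by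
    field_simp
    linear_combination (4 : realField R) * hrel
  have hint : IsIntegral ℤ ((2 * AdjoinRoot.root (realPolyQ R) + 3 + 1) / 2 : realField R) := by
    refine ⟨X ^ 2 - X - C 1, by monicity!, ?_⟩
    simp [hsq]
  refine ⟨⟨_, hint⟩, rfl, ?_⟩
  refine RingOfIntegers.ext ?_
  simp only [map_pow, map_add, map_one]
  exact hsq

omit [Fact (Irreducible (cmPolyQ R))] in
/-- **`F = ℚ(√5)` has exactly one dyadic place** (in this carrier's terms). [folklore] -/
theorem sqrtNeg1Sqrt5_ratPrimeRule_dyadic_unique (hR : R = X ^ 2 + C 3 * X + C 1) (v v' : HeightOneSpectrum (𝓞 (realField R)))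
    (h2 : (2 : 𝓞 (realField R)) ∈ v.asIdeal) (h2' : (2 : 𝓞 (realField R)) ∈ v'.asIdeal) : v = v' := by
  obtain ⟨s, -, hs⟩ := sqrtNeg1Sqrt5_ratPrimeRule_exists_golden hR
  have hx : ∀ w : HeightOneSpectrum (𝓞 (realField R)), s ^ 2 - s ∉ w.asIdeal := fun w h ↦
    w.isPrime.ne_top ((Ideal.eq_top_iff_one _).2 (by rwa [show s ^ 2 - s = 1 by rw [hs]; ring] at h))
  exact dyadic_unique_of_sq_sub_self_notMem (finrank_realField_quadratic hR) v v' h2 h2' (hx v) (hx v')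

/-- **`[2] = [1]`** for `ℚ(i,√5)`: `2 = x² - (-1)·y²` with `x = 1`, `y = 1` in `F` (a norm from `E`).
[cite: Deligne1982HodgeCycles, §4 Cor. 4.2] -/
theorem sqrtNeg1Sqrt5_ratPrimeRule_mk_two_eq_splitDiscriminantClassCM (hR : R = X ^ 2 + C 3 * X + C 1) (qℓ : (realField R)ˣ) (hq : (qℓ : realField R) = 2)
    {k : ℕ} (hk : Even k) : (QuotientGroup.mk qℓ : cmNormResidueGroup R) = splitDiscriminantClassCM R k := by
  have hrel := root_rel_quadratic hR
  push_cast at hrel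
  have hfac : AdjoinRoot.root (realPolyQ R) = ((1 : realField R) + (1 : realField R) * AdjoinRoot.root (realPolyQ R)) ^ 2 * (-1 : realField R) := by
    linear_combination (1 : realField R) * hrel
  exact mk_eq_splitDiscriminantClassCM_of_eq_sq_sub_mul_sq hfac qℓ (x := (1 : realField R)) (y := (1 : realField R))
    (by rw [hq]; linear_combination (0 : realField R) * hrel) hk

/-- **`[5] = [1]`** for `ℚ(i,√5)`: `5 = x² - (-1)·y²` with `x = 2*θ + 3`, `y = 0` in `F` (a norm from `E`).
[cite: Deligne1982HodgeCycles, §4 Cor. 4.2] -/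
theorem sqrtNeg1Sqrt5_ratPrimeRule_mk_five_eq_splitDiscriminantClassCM (hR : R = X ^ 2 + C 3 * X + C 1) (qℓ : (realField R)ˣ) (hq : (qℓ : realField R) = 5)
    {k : ℕ} (hk : Even k) : (QuotientGroup.mk qℓ : cmNormResidueGroup R) = splitDiscriminantClassCM R k := by
  have hrel := root_rel_quadratic hR
  push_cast at hrel
  have hfac : AdjoinRoot.root (realPolyQ R) = ((1 : realField R) + (1 : realField R) * AdjoinRoot.root (realPolyQ R)) ^ 2 * (-1 : realField R) := by
    linear_combination (1 : realField R) * hrel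
  exact mk_eq_splitDiscriminantClassCM_of_eq_sq_sub_mul_sq hfac qℓ (x := ((3 : realField R) + (2 : realField R) * AdjoinRoot.root (realPolyQ R))) (y := (0 : realField R))
    (by rw [hq]; linear_combination (-4 : realField R) * hrel) hk

/-- **THE RATIONAL PRIME RULE for `ℚ(i,√5)`**: for EVERY rational prime `ℓ`, the class `[ℓ]` of the census table
`W_{2k}.E.δ` (`k` even) is non-split iff **`ℓ ≡ 11, 19 (mod 20)`** — i.e. iff `ℓ` splits in `F = ℚ(√5)` into two places
inert in `E = F(√-1)` (`(5|ℓ) = 1`, `(-1|ℓ) = -1`); the primes `ℓ ∣ 2·5·1` are norms.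
[cite: Deligne1982HodgeCycles, §4 (1) and Cor. 4.2] [cite: Omeara1963, §63B Example 63:12 and §71D Thm. 71:18] -/
theorem sqrtNeg1Sqrt5_mk_prime_ne_splitDiscriminantClassCM_iff_mod (hR : R = X ^ 2 + C 3 * X + C 1) {ℓ : ℕ} (hℓ : ℓ.Prime)
    (qℓ : (realField R)ˣ) (hq : (qℓ : realField R) = ℓ) {k : ℕ} (hk : Even k) :
    (QuotientGroup.mk qℓ : cmNormResidueGroup R) ≠ splitDiscriminantClassCM R k ↔
      ℓ % 20 = 11 ∨ ℓ % 20 = 19 := by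
  by_cases h2 : ℓ = 2
  · subst h2
    exact iff_of_false (not_not.2 (sqrtNeg1Sqrt5_ratPrimeRule_mk_two_eq_splitDiscriminantClassCM hR qℓ (by rw [hq]; norm_num) hk))
      (by omega)
  by_cases h5 : ℓ = 5
  · subst h5
    exact iff_of_false (not_not.2 (sqrtNeg1Sqrt5_ratPrimeRule_mk_five_eq_splitDiscriminantClassCM hR qℓ (by rw [hq]; norm_num) hk))
      (by omega)
  haveI := Fact.mk hℓ
  obtain ⟨hRm, -⟩ := monic_and_natDegree_of_quadratic R hR
  obtain ⟨θₒ, hθ⟩ := exists_ringOfIntegers_coe_eq_root hRm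
  have hroots := roots_real_neg_of_quadratic hR (by norm_num) (by norm_num) (by norm_num)
  have hrel := root_rel_quadratic hR
  push_cast at hrel
  have hdisc : ¬ (ℓ : ℤ) ∣ (3 : ℤ) ^ 2 - 4 * 1 := fun h ↦ by
    have h' : ℓ ∣ 2 ^ 0 * 3 ^ 0 * 5 ^ 1 := by norm_num at h ⊢; exact_mod_cast h
    rcases eq_of_prime_dvd_two_pow_mul hℓ h' with rfl | rfl | rfl <;> omega
  have hm0 : (1 : ZMod ℓ) ≠ 0 := one_ne_zero
  have hfac : AdjoinRoot.root (realPolyQ R) = -((1 : realField R) + (1 : realField R) * AdjoinRoot.root (realPolyQ R)) ^ 2 := by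
    linear_combination (1 : realField R) * hrel
  rw [mk_natCast_ne_splitDiscriminantClassCM_iff_of_root_eq_neg_sq hR hroots hθ hfac (sqrtNeg1Sqrt5_ratPrimeRule_dyadic_unique hR) hℓ h2 hdisc
    qℓ hq hk]
  push_cast
  rw [show (5 : ZMod ℓ) = 5 * 1 ^ 2 by norm_num, isSquare_mul_sq_iff_of_ne_zero hm0, isSquare_five_iff h2 h5, ZMod.exists_sq_eq_neg_one_iff]
  have hodd : ℓ % 2 = 1 := (Nat.Prime.mod_two_eq_one_iff_ne_two hℓ).2 h2
  have h5' : ℓ % 5 ≠ 0 := fun h ↦ h5 ((Nat.prime_dvd_prime_iff_eq Nat.prime_five hℓ).1 (Nat.dvd_of_mod_eq_zero h)).symm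
  have key : ∀ n : ℕ, n % 2 = 1 → n % 5 ≠ 0 →
      (((n % 5 = 1 ∨ n % 5 = 4) ∧ ¬ (n % 4 ≠ 3)) ↔ (n % 20 = 11 ∨ n % 20 = 19)) := by
    intro n hn0 hn1
    obtain ⟨k', r, hr, rfl⟩ : ∃ k' r, r < 20 ∧ n = 20 * k' + r :=
      ⟨n / 20, n % 20, Nat.mod_lt _ (by norm_num), (Nat.div_add_mod n 20).symm⟩
    interval_cases r <;> omega
  exact key ℓ hodd h5'

end IsqrtNeg1Sqrt5


end Summit.HodgeConjecture.HodgeConjecture.Ring2.WeilCoverageCM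

end
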